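import Mathlib
import Summits.PneNP.PneNP.Theorems.OverlapGapAlgebraSolvableImpliesStableSectionTwoWayRepairBuildSlot

/-!
# PneNP / OverlapGapAlgebra — crux `SolvableImpliesStableSection` (stmt-PneNP-2463):
# the TWO-WAY REPAIR block (7a/·) — the slot data of a violated clause

Support for crux `stmt-PneNP-2463` (`Summit.PneNP.PneNP.Theses.OverlapGapAlgebra.SolvableImpliesStableSection`):
the f-free block "bounded-round two-way repair with one-round memory gives stable sections for every
`ν > 0` up to `α ≤ 2^k/(4k)`".  A clause `i` violated at round `t` with nominee `jf` (least slot in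
the priority order of `…TwoWayRepairDynamics`) becomes the root, of code `2t + [(i, jf) positive]`, of
a tree code: the nominee slot is left childless; every other slot whose variable flipped at the last
round bears the good code of its nominator at round `t - 1` (`sissW_child_recent`); every other positive
slot bears the good code of an earlier `true → false` flip of its variable (`sissW_child_positive`);
the remaining slots (negative, not flipped at the last round) are childless.  Then the nominee is the
least childless root slot (slots before it have higher priority class), it is the only childless slot
when it is positive, the two-way sign rule holds at the root, and the root is recent (a clause violated
at round `t ≥ 1` was satisfied at round `t - 1`, `sissW_newly_violated`):

* `sissW_nom_sign_false`, `sissW_build_children` — the nominee's class is least; the slot data (the assembling and the induction are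
  in `…TwoWayRepairBuild`).
No definitions (all objects are hypotheses); axioms `propext`, `Classical.choice`, `Quot.sound`.
-/

set_option linter.dupNamespace false -- `Summit.PneNP.PneNP.…`: summit = sub-problem (D-0017)

namespace Summit.PneNP.PneNP.Theorems

open Finset
open scoped Classical

section BuildData

variable {m k n : ℕ}

/-- **The nominee bounds every class from below**: if some slot is negative and did not flip at the
last round (class `0`), then so is the nominee; in particular the nominee slot is negative. -/
theorem sissW_nom_sign_false (val : ℕ → (Fin m → Fin k → Fin n × Bool) → Fin n → Bool) (t : ℕ) (Φ : (Fin m → Fin k → Fin n × Bool)) (i : Fin m)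
    (jf : Fin k) (hnom : (∀ j' : Fin k, (if 1 ≤ t ∧ val t Φ (Φ i jf).1 ≠ val (t - 1) Φ (Φ i jf).1 then (2 : ℕ)
          else if (Φ i jf).2 = true then 1 else 0) < (if 1 ≤ t ∧ val t Φ (Φ i j').1 ≠ val (t - 1) Φ (Φ i j').1 then (2 : ℕ)
          else if (Φ i j').2 = true then 1 else 0) ∨
        ((if 1 ≤ t ∧ val t Φ (Φ i jf).1 ≠ val (t - 1) Φ (Φ i jf).1 then (2 : ℕ)
          else if (Φ i jf).2 = true then 1 else 0) = (if 1 ≤ t ∧ val t Φ (Φ i j').1 ≠ val (t - 1) Φ (Φ i j').1 then (2 : ℕ)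
          else if (Φ i j').2 = true then 1 else 0) ∧ jf ≤ j'))) (j : Fin k)
    (hnrec : ¬ (1 ≤ t ∧ val t Φ (Φ i j).1 ≠ val (t - 1) Φ (Φ i j).1)) (hneg : (Φ i j).2 = false) : (Φ i jf).2 = false := by
  have h0 : (if 1 ≤ t ∧ val t Φ (Φ i j).1 ≠ val (t - 1) Φ (Φ i j).1 then (2 : ℕ)
          else if (Φ i j).2 = true then 1 else 0) = 0 := (sissW_key_eq_zero val t Φ i j).2 ⟨hnrec, hneg⟩
  have hle := sissW_nom_le val t Φ i jf hnom j
  rw [h0, Nat.le_zero] at hle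
  exact ((sissW_key_eq_zero val t Φ i jf).1 hle).2

/-- **The slot data of a violated clause.** For clause `i` violated at round `t` with nominee `jf`,
given good codes for the clauses violated before round `t`: optional subtrees `ch`, absent at `jf`,
a valid child (`…TwoWayRepairBuildSlot`) wherever present, present at every other slot that flipped at
the last round or is positive, and absent only at negative non-recent slots (besides `jf`). -/
theorem sissW_build_children (TS : ℕ → Finset (Finset (List (Fin k) × (Fin m × ℕ))))
    (val : ℕ → (Fin m → Fin k → Fin n × Bool) → Fin n → Bool)
    (hval0 : ∀ (Φ : (Fin m → Fin k → Fin n × Bool)) (v : Fin n), val 0 Φ v = true)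
    (hvalW : ∀ (t : ℕ) (Φ : (Fin m → Fin k → Fin n × Bool)) (v : Fin n), val (t + 1) Φ v = val t Φ v ↔
      ¬ (∃ ii : Fin m, (∀ jj : Fin k, val t Φ (Φ ii jj).1 ≠ (Φ ii jj).2) ∧
        ∃ jf : Fin k, (∀ j' : Fin k, (if 1 ≤ t ∧ val t Φ (Φ ii jf).1 ≠ val (t - 1) Φ (Φ ii jf).1 then (2 : ℕ)
          else if (Φ ii jf).2 = true then 1 else 0) < (if 1 ≤ t ∧ val t Φ (Φ ii j').1 ≠ val (t - 1) Φ (Φ ii j').1 then (2 : ℕ)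
          else if (Φ ii j').2 = true then 1 else 0) ∨
        ((if 1 ≤ t ∧ val t Φ (Φ ii jf).1 ≠ val (t - 1) Φ (Φ ii jf).1 then (2 : ℕ)
          else if (Φ ii jf).2 = true then 1 else 0) = (if 1 ≤ t ∧ val t Φ (Φ ii j').1 ≠ val (t - 1) Φ (Φ ii j').1 then (2 : ℕ)
          else if (Φ ii j').2 = true then 1 else 0) ∧ jf ≤ j')) ∧ (Φ ii jf).1 = v))
    (Φ : (Fin m → Fin k → Fin n × Bool)) (t : ℕ) (i : Fin m) (hviol : (∀ jj : Fin k, val t Φ (Φ i jj).1 ≠ (Φ i jj).2)) (jf : Fin k)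
    (hIH : (∀ s : ℕ, s < t → ∀ y : Fin m, (∀ jj : Fin k, val s Φ (Φ y jj).1 ≠ (Φ y jj).2) →
      ∃ (T : Finset (List (Fin k) × (Fin m × ℕ))) (r : ℕ) (jf : Fin k), (T ∈ TS s ∧ r / 2 = s ∧ (([] : List (Fin k)), (y, r)) ∈ T ∧
      (∀ e ∈ T, ∀ j : Fin k,
      (((Φ e.2.1 j).2 = true ↔ ((∃ (y : Fin m) (s : ℕ), (j :: e.1, (y, s)) ∈ T ∧ s % 2 = 0) ∨
        ((∀ lab : Fin m × ℕ, (j :: e.1, lab) ∉ T) ∧ e.2.2 % 2 = 1))) ∧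
      ∀ (y : Fin m) (s : ℕ), (j :: e.1, (y, s)) ∈ T → ∃ j' : Fin k,
        (∀ lab : Fin m × ℕ, (j' :: j :: e.1, lab) ∉ T) ∧
        (∀ j'' : Fin k, j'' < j' → ∃ lab : Fin m × ℕ, (j'' :: j :: e.1, lab) ∈ T) ∧
        (Φ e.2.1 j).1 = (Φ y j').1)) ∧
      ((∀ e ∈ T, ∀ (j : Fin k) (y : Fin m) (s : ℕ), (j :: e.1, (y, s)) ∈ T →
        s / 2 < e.2.2 / 2 ∧ ∃ j' : Fin k, ∀ lab : Fin m × ℕ, (j' :: j :: e.1, lab) ∉ T) ∧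
      (∀ e ∈ T, ∀ (j : Fin k) (y : Fin m) (s : ℕ), (j :: e.1, (y, s)) ∈ T → s % 2 = 1 →
        ∀ j₁ j₂ : Fin k, (∀ lab : Fin m × ℕ, (j₁ :: j :: e.1, lab) ∉ T) →
          (∀ lab : Fin m × ℕ, (j₂ :: j :: e.1, lab) ∉ T) → j₁ = j₂) ∧
      (∀ e ∈ T, 1 ≤ e.2.2 / 2 → ∃ (j : Fin k) (y : Fin m) (s : ℕ),
        (j :: e.1, (y, s)) ∈ T ∧ s / 2 + 1 = e.2.2 / 2)) ∧
      (∃ j : Fin k, ∀ lab : Fin m × ℕ, ([j], lab) ∉ T) ∧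
      (∀ (y : Fin m) (s : ℕ), (([] : List (Fin k)), (y, s)) ∈ T → s % 2 = 1 →
        ∀ j₁ j₂ : Fin k, (∀ lab : Fin m × ℕ, ([j₁], lab) ∉ T) →
          (∀ lab : Fin m × ℕ, ([j₂], lab) ∉ T) → j₁ = j₂) ∧
      (∀ j' : Fin k, (if 1 ≤ s ∧ val s Φ (Φ y jf).1 ≠ val (s - 1) Φ (Φ y jf).1 then (2 : ℕ)
          else if (Φ y jf).2 = true then 1 else 0) < (if 1 ≤ s ∧ val s Φ (Φ y j').1 ≠ val (s - 1) Φ (Φ y j').1 then (2 : ℕ)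
          else if (Φ y j').2 = true then 1 else 0) ∨
        ((if 1 ≤ s ∧ val s Φ (Φ y jf).1 ≠ val (s - 1) Φ (Φ y jf).1 then (2 : ℕ)
          else if (Φ y jf).2 = true then 1 else 0) = (if 1 ≤ s ∧ val s Φ (Φ y j').1 ≠ val (s - 1) Φ (Φ y j').1 then (2 : ℕ)
          else if (Φ y j').2 = true then 1 else 0) ∧ jf ≤ j')) ∧
      (∀ lab : Fin m × ℕ, ([jf], lab) ∉ T) ∧ (∀ j'' : Fin k, j'' < jf → ∃ lab : Fin m × ℕ, ([j''], lab) ∈ T) ∧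
      (r % 2 = 1 ↔ (Φ y jf).2 = true)))) :
    ∃ ch : Fin k → Option (Finset (List (Fin k) × (Fin m × ℕ))),
      ch jf = none ∧
      (∀ (j : Fin k) (S : Finset (List (Fin k) × (Fin m × ℕ))), ch j = some S → (∃ (y : Fin m) (s r' : ℕ) (jf' : Fin k), s < t ∧ S ∈ TS s ∧ (([] : List (Fin k)), (y, r')) ∈ S ∧ r' / 2 = s ∧
      (∀ e ∈ S, ∀ j : Fin k,
      (((Φ e.2.1 j).2 = true ↔ ((∃ (y : Fin m) (s : ℕ), (j :: e.1, (y, s)) ∈ S ∧ s % 2 = 0) ∨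
        ((∀ lab : Fin m × ℕ, (j :: e.1, lab) ∉ S) ∧ e.2.2 % 2 = 1))) ∧
      ∀ (y : Fin m) (s : ℕ), (j :: e.1, (y, s)) ∈ S → ∃ j' : Fin k,
        (∀ lab : Fin m × ℕ, (j' :: j :: e.1, lab) ∉ S) ∧
        (∀ j'' : Fin k, j'' < j' → ∃ lab : Fin m × ℕ, (j'' :: j :: e.1, lab) ∈ S) ∧
        (Φ e.2.1 j).1 = (Φ y j').1)) ∧
      ((∀ e ∈ S, ∀ (j : Fin k) (y : Fin m) (s : ℕ), (j :: e.1, (y, s)) ∈ S →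
        s / 2 < e.2.2 / 2 ∧ ∃ j' : Fin k, ∀ lab : Fin m × ℕ, (j' :: j :: e.1, lab) ∉ S) ∧
      (∀ e ∈ S, ∀ (j : Fin k) (y : Fin m) (s : ℕ), (j :: e.1, (y, s)) ∈ S → s % 2 = 1 →
        ∀ j₁ j₂ : Fin k, (∀ lab : Fin m × ℕ, (j₁ :: j :: e.1, lab) ∉ S) →
          (∀ lab : Fin m × ℕ, (j₂ :: j :: e.1, lab) ∉ S) → j₁ = j₂) ∧
      (∀ e ∈ S, 1 ≤ e.2.2 / 2 → ∃ (j : Fin k) (y : Fin m) (s : ℕ),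
        (j :: e.1, (y, s)) ∈ S ∧ s / 2 + 1 = e.2.2 / 2)) ∧
      (∃ j : Fin k, ∀ lab : Fin m × ℕ, ([j], lab) ∉ S) ∧
      (∀ (y : Fin m) (s : ℕ), (([] : List (Fin k)), (y, s)) ∈ S → s % 2 = 1 →
        ∀ j₁ j₂ : Fin k, (∀ lab : Fin m × ℕ, ([j₁], lab) ∉ S) →
          (∀ lab : Fin m × ℕ, ([j₂], lab) ∉ S) → j₁ = j₂) ∧
      (∀ lab : Fin m × ℕ, ([jf'], lab) ∉ S) ∧ (∀ j'' : Fin k, j'' < jf' → ∃ lab : Fin m × ℕ, ([j''], lab) ∈ S) ∧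
      (Φ i j).1 = (Φ y jf').1 ∧ (((Φ i j).2 = true) ↔ r' % 2 = 0) ∧
      ((1 ≤ t ∧ val t Φ (Φ i j).1 ≠ val (t - 1) Φ (Φ i j).1) → s + 1 = t))) ∧
      (∀ j : Fin k, j ≠ jf → (((1 ≤ t ∧ val t Φ (Φ i j).1 ≠ val (t - 1) Φ (Φ i j).1)) ∨ (Φ i j).2 = true) → ch j ≠ none) ∧
      (∀ j : Fin k, ch j = none → j ≠ jf → ¬ ((1 ≤ t ∧ val t Φ (Φ i j).1 ≠ val (t - 1) Φ (Φ i j).1)) ∧ (Φ i j).2 = false) := by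
  have key : ∀ j : Fin k, ∃ o : Option (Finset (List (Fin k) × (Fin m × ℕ))),
      (j = jf → o = none) ∧
      (∀ S : Finset (List (Fin k) × (Fin m × ℕ)), o = some S → (∃ (y : Fin m) (s r' : ℕ) (jf' : Fin k), s < t ∧ S ∈ TS s ∧ (([] : List (Fin k)), (y, r')) ∈ S ∧ r' / 2 = s ∧
      (∀ e ∈ S, ∀ j : Fin k,
      (((Φ e.2.1 j).2 = true ↔ ((∃ (y : Fin m) (s : ℕ), (j :: e.1, (y, s)) ∈ S ∧ s % 2 = 0) ∨
        ((∀ lab : Fin m × ℕ, (j :: e.1, lab) ∉ S) ∧ e.2.2 % 2 = 1))) ∧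
      ∀ (y : Fin m) (s : ℕ), (j :: e.1, (y, s)) ∈ S → ∃ j' : Fin k,
        (∀ lab : Fin m × ℕ, (j' :: j :: e.1, lab) ∉ S) ∧
        (∀ j'' : Fin k, j'' < j' → ∃ lab : Fin m × ℕ, (j'' :: j :: e.1, lab) ∈ S) ∧
        (Φ e.2.1 j).1 = (Φ y j').1)) ∧
      ((∀ e ∈ S, ∀ (j : Fin k) (y : Fin m) (s : ℕ), (j :: e.1, (y, s)) ∈ S →
        s / 2 < e.2.2 / 2 ∧ ∃ j' : Fin k, ∀ lab : Fin m × ℕ, (j' :: j :: e.1, lab) ∉ S) ∧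
      (∀ e ∈ S, ∀ (j : Fin k) (y : Fin m) (s : ℕ), (j :: e.1, (y, s)) ∈ S → s % 2 = 1 →
        ∀ j₁ j₂ : Fin k, (∀ lab : Fin m × ℕ, (j₁ :: j :: e.1, lab) ∉ S) →
          (∀ lab : Fin m × ℕ, (j₂ :: j :: e.1, lab) ∉ S) → j₁ = j₂) ∧
      (∀ e ∈ S, 1 ≤ e.2.2 / 2 → ∃ (j : Fin k) (y : Fin m) (s : ℕ),
        (j :: e.1, (y, s)) ∈ S ∧ s / 2 + 1 = e.2.2 / 2)) ∧
      (∃ j : Fin k, ∀ lab : Fin m × ℕ, ([j], lab) ∉ S) ∧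
      (∀ (y : Fin m) (s : ℕ), (([] : List (Fin k)), (y, s)) ∈ S → s % 2 = 1 →
        ∀ j₁ j₂ : Fin k, (∀ lab : Fin m × ℕ, ([j₁], lab) ∉ S) →
          (∀ lab : Fin m × ℕ, ([j₂], lab) ∉ S) → j₁ = j₂) ∧
      (∀ lab : Fin m × ℕ, ([jf'], lab) ∉ S) ∧ (∀ j'' : Fin k, j'' < jf' → ∃ lab : Fin m × ℕ, ([j''], lab) ∈ S) ∧
      (Φ i j).1 = (Φ y jf').1 ∧ (((Φ i j).2 = true) ↔ r' % 2 = 0) ∧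
      ((1 ≤ t ∧ val t Φ (Φ i j).1 ≠ val (t - 1) Φ (Φ i j).1) → s + 1 = t))) ∧
      (j ≠ jf → (((1 ≤ t ∧ val t Φ (Φ i j).1 ≠ val (t - 1) Φ (Φ i j).1)) ∨ (Φ i j).2 = true) → o ≠ none) ∧
      (o = none → j ≠ jf → ¬ ((1 ≤ t ∧ val t Φ (Φ i j).1 ≠ val (t - 1) Φ (Φ i j).1)) ∧ (Φ i j).2 = false) := by
    intro j
    by_cases hj : j = jf
    · exact ⟨none, fun _ => rfl, fun S h => absurd h (by simp), fun h => absurd hj h, fun _ h => absurd hj h⟩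
    · by_cases hrec : (1 ≤ t ∧ val t Φ (Φ i j).1 ≠ val (t - 1) Φ (Φ i j).1)
      · obtain ⟨S, hS⟩ := sissW_child_recent TS val hvalW Φ t i j hviol hrec hIH
        refine ⟨some S, fun h => absurd h hj, fun S' h => ?_, fun _ _ h => absurd h (by simp),
          fun h => absurd h (by simp)⟩
        have hSS : S = S' := Option.some_injective _ h
        subst hSS
        exact hS
      · by_cases hpos : (Φ i j).2 = true
        · obtain ⟨S, hS⟩ := sissW_child_positive TS val hval0 hvalW Φ t i j hviol hrec hpos hIH
          refine ⟨some S, fun h => absurd h hj, fun S' h => ?_, fun _ _ h => absurd h (by simp),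
            fun h => absurd h (by simp)⟩
          have hSS : S = S' := Option.some_injective _ h
          subst hSS
          exact hS
        · refine ⟨none, fun _ => rfl, fun S h => absurd h (by simp), fun _ h => ?_,
            fun _ _ => ⟨hrec, by simpa using hpos⟩⟩
          rcases h with h | h
          · exact absurd h hrec
          · exact absurd h hpos
  choose ch hch using key
  exact ⟨ch, (hch jf).1 rfl, fun j S h => (hch j).2.1 S h, fun j hj h => (hch j).2.2.1 hj h,
    fun j h hj => (hch j).2.2.2 h hj⟩

end BuildData

end Summit.PneNP.PneNP.Theorems
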